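import Summits.AnomalousDissipation.AnomalousDissipation.Theses.LandauJetArena
import HarnessLib

/-!
# Route LandauJetArena — the support glue `CruxesGiveJetPairZerothLaw`

Proof of the route declaration
`Summit.AnomalousDissipation.AnomalousDissipation.Theses.LandauJetArena.CruxesGiveJetPairZerothLaw`
(item stmt-AnomalousDissipation-14187): the crux layer reaches the route target BY NAME,
`JetPairDissipationFloor → JetPairBoundedEnergyFamily → JetPairZerothLaw`.

This is pure logic (the same argument as the expanded glue `FloorAndFamilyGiveTarget`, to which this
statement is definitionally equal). Take the configuration `(ρ, a, φ, f)`, the energy level `E` and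
the family `(ν, u₀, u)` from `JetPairBoundedEnergyFamily`; `JetPairDissipationFloor` at that
configuration and that `E` gives `ε > 0` and `ν₀ > 0`; since `ν j → 0` there is `J` with `ν j ≤ ν₀`
for all `j ≥ J`; the reindexed family `j ↦ j + J` is still a vanishing-viscosity family of global
Leray–Hopf solutions driven by `f` with mean energies `≤ E`, and the floor applies to every member,
giving mean dissipation `≥ ε`, which is `JetPairZerothLaw` for the configuration `(ρ, a, φ, f)`.
-/

namespace Summit.AnomalousDissipation.AnomalousDissipation.Theorems

-- the mandated namespace `Summit.<Summit>.<Problem>.Theorems` repeats `AnomalousDissipation` (single-problem summit)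
set_option linter.dupNamespace false

open Filter Topology
open Summit.AnomalousDissipation.AnomalousDissipation.Theses.LandauJetArena

/-- **The cruxes give the jet-pair zeroth law.**
`JetPairDissipationFloor → JetPairBoundedEnergyFamily → JetPairZerothLaw`:
take the configuration `(ρ, a, φ, f)`, the level `E` and the family `(ν, u₀, u)` from the
bounded-energy family (crux r4); the dissipation floor (crux r2) at that configuration and `E`
gives `ε > 0`, `ν₀ > 0`; `Tendsto ν atTop (𝓝 0)` gives `J` with `ν j ≤ ν₀` for `j ≥ J`
(`Tendsto.eventually` + `eventually_atTop`); reindex `j ↦ j + J` (`tendsto_add_atTop_nat`), keep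
the energy bound `E`, and apply the floor to every reindexed member.
Closes item stmt-AnomalousDissipation-14187. -/
theorem CruxesGiveJetPairZerothLaw_proof :
    Summit.AnomalousDissipation.AnomalousDissipation.Theses.LandauJetArena.CruxesGiveJetPairZerothLaw := by
  unfold CruxesGiveJetPairZerothLaw
  intro hFloor hFam
  obtain ⟨ρ, a, φ, f, hcfg, E, ν, u₀, u, hν, hT, hLH, hE⟩ := hFam
  obtain ⟨ε, hε, ν₀, hν₀, hfl⟩ := hFloor ρ a φ f hcfg E
  obtain ⟨J, hJ⟩ := eventually_atTop.1 (hT.eventually (Iic_mem_nhds hν₀))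
  refine ⟨ρ, a, φ, f, hcfg, fun j => ν (j + J), fun j => u₀ (j + J), fun j => u (j + J),
    fun j => hν (j + J), hT.comp (tendsto_add_atTop_nat J), fun j => hLH (j + J),
    ⟨E, fun j => hE (j + J)⟩, ε, hε, fun j => ?_⟩
  exact hfl (ν (j + J)) (u₀ (j + J)) (u (j + J)) (hν (j + J)) (hJ (j + J) (Nat.le_add_left J j))
    (hLH (j + J)) (hE (j + J))

end Summit.AnomalousDissipation.AnomalousDissipation.Theorems
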